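import Mathlib
import Literature.MathematicalPhysics.QuantumLattice.FermiRG.Salmhofer1998Sec5
import HarnessLib

/-!
# Salmhofer 1998, Proposition 4 (bounds on the finite-volume cutoff propagator) — PROOF

M. Salmhofer, *Continuous renormalization for fermions and Fermi liquid theory*, Commun. Math. Phys.
**194** (1998) 249–295 = arXiv:cond-mat/9706188 [Salmhofer1998], §5.2 Proposition 4 (render
`paper:arxiv-cond-mat_9706188`, statement p.18 L45–76, proof p.18 L78–96) together with the appendix
Lemma 9 (TeX `LemA1`, p.28 L45–57, proof L59–96) that the printed proof invokes three times.  Locators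
`p.N Ln` = chunk `pNNNN.txt` line `n` of the materialised arXiv TeX, as in the statement file.

This file DISCHARGES the named fact
`Literature.MathematicalPhysics.QuantumLattice.FermiRG.Salmhofer1998.FiniteVolumePropagatorBounds`
(licence F-083 of the gate-hubbard-kl statements-first wave, typed in `Salmhofer1998Sec5.lean`, which is
imported UNCHANGED):

`theorem FiniteVolumePropagatorBounds_holds : FiniteVolumePropagatorBounds`,

and proves Lemma 9 on the way (`lemma9_pointwise`, `lemma9_sum`).  No new definition, no new named
fact, no `sorry`: net fact debt `-1`.

## The printed proof and how it is followed

Write `D̂_t(k) = χ₁(ε_t⁻²|iω̂ - E(𝐤)|²)/(iω̂ - E(𝐤))` ((5.9); `cutoffCov`) as `χ₁(A e^{2t})/c` with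
`c = iω̂ - E(𝐤)`, `A = |c|²/ε₀²` (`cutoffCov_eq`; (5.8) `ε_t = ε₀e^{-t}`).  In real coordinates
`Re ω̂ = sin(ε_τω)/ε_τ`, `Im ω̂ = (1 - cos(ε_τω))/ε_τ` (`omegaHat_re/im`, p.28 L60–61), and for
`ω = ω_n = π(2n+1)/β ∈ 𝕄_{n_τ}` the angle is `ε_τω_n = π(2n+1)/n_τ ∈ [-π, π]` with `2n+1` odd,
`1 ≤ |2n+1| ≤ n_τ - 1` (`matsIdx`).

* p.18 L79–80 "`χ₁(x) = 0` if `x ≥ 1`, so `C_t(k) ≠ 0` implies `|iω̂ - E| ≤ ε_t`":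
  `norm_lt_of_cutoffCov_ne_zero`, `norm_cutoffCov_le`.
* p.18 L83 "`|iω̂ - E(𝐤)| ≥ |Re ω̂| ≥ 2/β`": `two_div_beta_le_norm_propDenom` (Jordan's inequality on the
  half period: the angle `π(2n+1)/n_τ` stays at distance `≥ π/n_τ` from `πℤ`, so `|sin| ≥ 2/n_τ` and
  `|Re ω̂| ≥ (2/n_τ)/ε_τ = 2/β`).  From it: `D̂_t ≡ 0` for `t > log(βε₀/2)` (`cutoffCov_eq_zero_of_log_lt`;
  the print phrases this step through Lemma 9's `|ω| ≤ (π/2)ε_t` and `|ω| ≥ π/β` — same inequality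
  `ε_t ≥ 2/β` on the support), `|D̂_t| ≤ (β/2)·1` and `4ε_t⁻¹·1 ≤ 2β·1` (`norm_cutoffCov_le_half_beta`,
  `four_inv_epsT_le_two_beta`).
* p.18 L85–91, the `t`-derivative `|∂_tC_t(k)| = 2ε_t⁻²|iω̂ - E||χ₁'(ε_t⁻²|iω̂ - E|²)|` and "`χ₁'(x) = 0`
  for `x ∉ (1/4,1)`": `hasDerivAt_cutoffComp` (chain rule), the two local-constancy lemmas
  `deriv_cutoffComp_eq_zero_of_one_lt/_of_lt_quarter` (support of `Ḋ̂_t`, `shell_of_cutoffCovDot_ne_zero`),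
  and `norm_cutoffCovDot_le` (`|χ₁'| ≤ 2` ⇒ `|Ḋ̂_t| ≤ 4ε_t⁻¹·1`).  Smoothness in `t`
  (`contDiff_cutoffCov`) is the composition of `χ₁ ∈ C^∞(ℝ₀⁺)` with the smooth positive argument
  (constant if `A = 0`).
* p.18 L93–95, the integrals "by Lemma (LemA1), by Vobou": `momSum_norm_cutoffCovDot_le`
  (`∫|Ḋ̂_t| ≤ 4ε_t⁻¹ · L^{-d}Σ_𝐤 β⁻¹Σ_ω 1 ≤ 4ε_t⁻¹ · ε_t · L^{-d}#{|E| ≤ 2ε_t} ≤ 4V₁`, using Lemma 9's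
  counting half `lemma9_sum` and `2ε_t ≤ 2ε₀ ≤ 2`).
* Lemma 9 itself is proved as printed (p.28 L59–96): `|Re ω̂| ≤ E₀`, `|Im ω̂ + E| ≤ E₀` ⇒
  `1 - cos(ωε_τ) ≤ ε_τ(E₀ + E_max) ≤ 1/2` ⇒ `|ωε_τ| ≤ π/2` (we read it off the monotonicity of `cos`,
  getting `π/3`; print uses `1 - cos x ≥ 2x²/π²`) ⇒ Jordan `|ω| ≤ (π/2)|Re ω̂| ≤ (π/2)E₀` ⇒
  `|Im ω̂| ≤ ε_τω²/2 ≤ (π²/8)βE₀²/n_τ ≤ E₀` ⇒ `|E| ≤ 2E₀`; and `β⁻¹#{n : |2n+1| ≤ βE₀/2} ≤ E₀` (empty if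
  `βE₀/2 < 1`, else `≤ β⁻¹(βE₀/2 + 1) ≤ E₀`; `card_le_of_abs_two_mul_add_one_le`).

## One deviation (disclosed): the last display `∫_{Λ*} dk |D̂_t(k)| ≤ V₁ log(βε₀/2)`

The printed one-line route "by `C_t = ∫_t^{log(βε₀/2)} ds Ċ_s`" combined with the previous display
`∫|Ċ_s| ≤ 4V₁` yields `4V₁(log(βε₀/2) - t)`, i.e. the printed constant up to a factor `4` (integrating the
pointwise bound in `s` first gives back exactly `|D̂_t(k)| ≤ 1(·)/|iω̂ - E|`, no better).  The typed clause
keeps the PRINTED constant `V₁ log(βε₀/2)`, and it is TRUE; we prove it directly, without the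
`s`-integral: on the support, `|D̂_t(k)| ≤ 1/|iω̂ - E| ≤ ε_τ/|sin(π(2n+1)/n_τ)|`; Lemma 9 gives
`|2n+1| ≤ R := βε_t/2`, and the standing `n_τ ≥ 2β(ε₀ + E_max) ≥ 4R` puts the angle in `[0, π/4]`, where
the chord of the concave `sin` gives `|sin y| ≥ (2√2/π)|y|` (`chord_mul_le_sin`); hence
`β⁻¹|iω̂_n - E|⁻¹ ≤ 1/(2√2|2n+1|)` (`per_term_bound`) and
`β⁻¹Σ_ω 1(·)/|iω̂ - E| ≤ (1/√2) Σ_{odd m ≤ R} 1/m ≤ (1/√2) max(1, 4/3 + ½ log(R/3)) ≤ log(βε₀/2)`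
(`odd_harmonic_le_log` by telescoping `1/m ≤ ½ log(m/(m-2))`, `sum_inv_odd_le`, and the numerical
`max_le_sqrt_two_mul_log`, which uses only `log 2 > 0.6931`, `log(3/2) ≥ 1/3`, `√2 ≥ 1.414`, `βε₀ ≥ 6`);
the volume bound then gives `V₁ log(βε₀/2)` (`inner_sum_le`, `momSum_norm_cutoffCov_le`).  A numerical
sanity check of the true worst case (seat folder `scratch/check_e.py`: `βε₀ = 6`, `t = 0`, `n_τ = 12`)
gives the ratio `0.58` of the left side to `V₁ log(βε₀/2)`, so the printed display holds with room; only
its one-line justification is short by the factor `4`.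

Hypotheses of the typed fact that are NOT needed by the proof (kept, as printed/typed): `Even n_τ`
(the bounds use only `-n_τ/2 ≤ n < n_τ/2`), `0 < L`, and `M.Hyp` beyond `0 < ε₀ ≤ 1`.

No `instance`, no `notation`, nothing about the Hubbard model is asserted or denied; no sorry/axiom.
-/

noncomputable section

open MeasureTheory Filter Finset
open scoped Topology

namespace Literature.MathematicalPhysics.QuantumLattice.FermiRG

namespace Salmhofer1998

variable {d : ℕ}

/-! ### The symbol `ω̂` and the denominator `iω̂ - E` in real coordinates; the bound `|iω̂ - E| ≥ 2/β` -/

/-- `ω̂ = sin(ε_τω)/ε_τ + i(1 - cos(ε_τω))/ε_τ`: the symbol of the discrete time derivative in real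
coordinates ("By Hatomdef, Im ω̂ = ε_τ⁻¹(1 - cos(ωε_τ)) and Re ω̂ = ε_τ⁻¹ sin(ωε_τ)").
[cite: Salmhofer1998, Lemma 9 (appendix, TeX LemA1) proof (p.28 L60–61)] -/
theorem omegaHat_eq {ετ : ℝ} (hετ : ετ ≠ 0) (ω : ℝ) :
    omegaHat ετ ω = ((Real.sin (ετ * ω) / ετ : ℝ) : ℂ) +
      (((1 - Real.cos (ετ * ω)) / ετ : ℝ) : ℂ) * Complex.I := by
  unfold omegaHat
  set y : ℝ := ετ * ω with hy
  have hI : Complex.I * (ετ : ℂ) ≠ 0 := mul_ne_zero Complex.I_ne_zero (by exact_mod_cast hετ)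
  rw [div_eq_iff hI, mul_comm Complex.I (y : ℂ), Complex.exp_mul_I]
  apply Complex.ext
  · simp only [Complex.sub_re, Complex.add_re, Complex.mul_re, Complex.cos_ofReal_re,
      Complex.sin_ofReal_re, Complex.sin_ofReal_im, Complex.I_re, Complex.I_im, Complex.one_re,
      Complex.ofReal_re, Complex.ofReal_im, Complex.mul_im, Complex.add_im]
    field_simp
    ring
  · simp only [Complex.sub_im, Complex.add_im, Complex.mul_im, Complex.cos_ofReal_im,
      Complex.sin_ofReal_re, Complex.sin_ofReal_im, Complex.I_re, Complex.I_im, Complex.one_im,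
      Complex.ofReal_re, Complex.ofReal_im, Complex.mul_re, Complex.add_re]
    field_simp
    ring

/-- `Re ω̂ = sin(ε_τ ω)/ε_τ`. [cite: Salmhofer1998, Lemma 9 (appendix, TeX LemA1) proof (p.28 L60–61)] -/
theorem omegaHat_re {ετ : ℝ} (hετ : ετ ≠ 0) (ω : ℝ) :
    (omegaHat ετ ω).re = Real.sin (ετ * ω) / ετ := by
  rw [omegaHat_eq hετ]
  simp only [Complex.add_re, Complex.ofReal_re, Complex.mul_re, Complex.ofReal_im, Complex.I_re,
    Complex.I_im]
  ring

/-- `Im ω̂ = (1 - cos(ε_τ ω))/ε_τ`. [cite: Salmhofer1998, Lemma 9 (appendix, TeX LemA1) proof (p.28 L60–61)] -/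
theorem omegaHat_im {ετ : ℝ} (hετ : ετ ≠ 0) (ω : ℝ) :
    (omegaHat ετ ω).im = (1 - Real.cos (ετ * ω)) / ετ := by
  rw [omegaHat_eq hετ]
  simp only [Complex.add_im, Complex.ofReal_re, Complex.mul_im, Complex.ofReal_im, Complex.I_re,
    Complex.I_im]
  ring

/-- `Re(iω̂ - E) = -(Im ω̂ + E) = -((1 - cos(ε_τω))/ε_τ) - E`. [cite: Salmhofer1998, Lemma 9 (appendix, TeX LemA1) proof (p.28 L60–64)] -/
theorem propDenom_re (M : ModelData d) {β : ℝ} {nτ : ℕ} (hετ : epsTau β nτ ≠ 0) (ω : ℝ) (k : Mom d) :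
    (propDenom M β nτ ω k).re =
      -((1 - Real.cos (epsTau β nτ * ω)) / epsTau β nτ) - M.E k := by
  unfold propDenom
  simp only [Complex.sub_re, Complex.mul_re, Complex.I_re, omegaHat_re hετ, Complex.I_im,
    omegaHat_im hετ, Complex.ofReal_re]
  ring

/-- `Im(iω̂ - E) = Re ω̂ = sin(ε_τω)/ε_τ`. [cite: Salmhofer1998, Lemma 9 (appendix, TeX LemA1) proof (p.28 L60–64)] -/
theorem propDenom_im (M : ModelData d) {β : ℝ} {nτ : ℕ} (hετ : epsTau β nτ ≠ 0) (ω : ℝ) (k : Mom d) :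
    (propDenom M β nτ ω k).im = Real.sin (epsTau β nτ * ω) / epsTau β nτ := by
  unfold propDenom
  simp only [Complex.sub_im, Complex.mul_im, Complex.I_re, omegaHat_im hετ, Complex.I_im,
    omegaHat_re hετ, Complex.ofReal_im]
  ring

/-- `|Re ω̂| = |sin(ε_τ ω)|/ε_τ ≤ |iω̂ - E|` ("`|iω̂ - E| ≤ E₀` implies `|Re ω̂| ≤ E₀`").
[cite: Salmhofer1998, Lemma 9 (appendix, TeX LemA1) proof (p.28 L62–63)] -/
theorem abs_sin_div_le_norm_propDenom (M : ModelData d) {β : ℝ} {nτ : ℕ} (hετ : 0 < epsTau β nτ)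
    (ω : ℝ) (k : Mom d) :
    |Real.sin (epsTau β nτ * ω)| / epsTau β nτ ≤ ‖propDenom M β nτ ω k‖ := by
  have h := Complex.abs_im_le_norm (propDenom M β nτ ω k)
  rw [propDenom_im M hετ.ne' ω k, abs_div, abs_of_pos hετ] at h
  exact h

/-- `|Im ω̂ + E| = |(1 - cos(ε_τ ω))/ε_τ + E| ≤ |iω̂ - E|` ("and `|Im ω̂ + E(𝐤)| ≤ E₀`").
[cite: Salmhofer1998, Lemma 9 (appendix, TeX LemA1) proof (p.28 L62–64)] -/
theorem abs_re_le_norm_propDenom (M : ModelData d) {β : ℝ} {nτ : ℕ} (hετ : epsTau β nτ ≠ 0)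
    (ω : ℝ) (k : Mom d) :
    |(1 - Real.cos (epsTau β nτ * ω)) / epsTau β nτ + M.E k| ≤ ‖propDenom M β nτ ω k‖ := by
  have h := Complex.abs_re_le_norm (propDenom M β nτ ω k)
  rw [propDenom_re M hετ ω k] at h
  rwa [show -((1 - Real.cos (epsTau β nτ * ω)) / epsTau β nτ) - M.E k =
    -((1 - Real.cos (epsTau β nτ * ω)) / epsTau β nτ + M.E k) by ring, abs_neg] at h

/-- The angle of a Matsubara frequency: `ε_τ ω_n = π(2n+1)/n_τ` (`ω_n = π(2n+1)/β`, `ε_τ = β/n_τ`).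
[cite: Salmhofer1998, §2.2 (p.6 L75–79) and §2.1 (p.5 L101)] -/
theorem epsTau_mul_matsFreq {β : ℝ} (hβ : β ≠ 0) (nτ : ℕ) (n : ℤ) :
    epsTau β nτ * matsFreq β n = Real.pi * (2 * n + 1) / nτ := by
  unfold epsTau matsFreq
  rcases eq_or_ne (nτ : ℝ) 0 with h | h
  · simp [h]
  · field_simp

/-- `ε_τ = β/n_τ > 0`. [cite: Salmhofer1998, §2.1 (p.5 L101)] -/
theorem epsTau_pos {β : ℝ} (hβ : 0 < β) {nτ : ℕ} (hn : 0 < nτ) : 0 < epsTau β nτ :=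
  div_pos hβ (by exact_mod_cast hn)

/-- Jordan's inequality on the half-period, `2δ ≤ sin(πu)` for `δ ≤ u ≤ 1 - δ` — the elementary fact behind
"`|iω̂ - E(𝐤)| ≥ |Re ω̂| ≥ 2/β`" (`sin x/x` decreasing on `[0, π/2]`). [cite: Salmhofer1998, Proposition 4 proof (p.18 L83); Lemma 9 proof (p.28 L70–72)] -/
theorem two_mul_le_sin_pi_mul_of_mem {u δ : ℝ} (hδ : 0 ≤ δ) (h1 : δ ≤ u) (h2 : u ≤ 1 - δ) :
    2 * δ ≤ Real.sin (Real.pi * u) := by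
  have hπ := Real.pi_pos
  rcases le_or_gt u (1 / 2) with hu | hu
  · have hx : 0 ≤ Real.pi * u := by nlinarith
    have hx' : Real.pi * u ≤ Real.pi / 2 := by nlinarith
    have hj := Real.mul_le_sin hx hx'
    have : 2 / Real.pi * (Real.pi * u) = 2 * u := by field_simp
    rw [this] at hj
    linarith
  · have hx : 0 ≤ Real.pi * (1 - u) := by nlinarith
    have hx' : Real.pi * (1 - u) ≤ Real.pi / 2 := by nlinarith
    have hj := Real.mul_le_sin hx hx'
    have : 2 / Real.pi * (Real.pi * (1 - u)) = 2 * (1 - u) := by field_simp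
    rw [this, show Real.pi * (1 - u) = Real.pi - Real.pi * u by ring, Real.sin_pi_sub] at hj
    linarith

/-- The range of the Matsubara index (over `ℤ`): for `n ∈ matsIdx n_τ` (`-n_τ/2 ≤ n < n_τ/2`, integer
division), `1 ≤ |2n+1| ≤ n_τ - 1` ("`2n+1` is always odd"). [cite: Salmhofer1998, §2.2 (p.6 L75–79); Lemma 9 proof (p.28 L94–95)] -/
theorem abs_two_mul_add_one_le_int {nτ : ℕ} {n : ℤ} (hn : n ∈ matsIdx nτ) :
    (1 : ℤ) ≤ |2 * n + 1| ∧ |2 * n + 1| ≤ (nτ : ℤ) - 1 := by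
  simp only [matsIdx, Finset.mem_Ico] at hn
  have h2 : 2 * ((nτ / 2 : ℕ) : ℤ) ≤ (nτ : ℤ) := by omega
  constructor
  · rw [Int.abs_eq_natAbs]; omega
  · rw [abs_le]; constructor <;> omega

/-- The same range statement over `ℝ`: `1 ≤ |2n+1| ≤ n_τ - 1`. [cite: Salmhofer1998, §2.2 (p.6 L75–79); Lemma 9 proof (p.28 L94–95)] -/
theorem abs_two_mul_add_one_le {nτ : ℕ} {n : ℤ} (hn : n ∈ matsIdx nτ) :
    (1 : ℝ) ≤ |(2 * n + 1 : ℝ)| ∧ |(2 * n + 1 : ℝ)| ≤ (nτ : ℝ) - 1 := by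
  obtain ⟨h1, h2⟩ := abs_two_mul_add_one_le_int hn
  have hcast : ((2 * n + 1 : ℤ) : ℝ) = (2 * n + 1 : ℝ) := by push_cast; ring
  have h1' : ((1 : ℤ) : ℝ) ≤ ((|2 * n + 1| : ℤ) : ℝ) := by exact_mod_cast h1
  have h2' : ((|2 * n + 1| : ℤ) : ℝ) ≤ ((nτ : ℤ) - 1 : ℤ) := by exact_mod_cast h2
  rw [Int.cast_abs, hcast] at h1' h2'
  push_cast at h1' h2'
  exact ⟨h1', h2'⟩

/-- For `n ∈ matsIdx n_τ`: `2/n_τ ≤ |sin(π(2n+1)/n_τ)|` (the angle stays at distance `≥ π/n_τ` from `πℤ`).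
[cite: Salmhofer1998, Proposition 4 proof (p.18 L83)] -/
theorem two_div_le_abs_sin {nτ : ℕ} (hpos : 0 < nτ) {n : ℤ} (hn : n ∈ matsIdx nτ) :
    2 / (nτ : ℝ) ≤ |Real.sin (Real.pi * (2 * n + 1) / nτ)| := by
  have hnpos : (0 : ℝ) < nτ := by exact_mod_cast hpos
  obtain ⟨h1, h2⟩ := abs_two_mul_add_one_le hn
  set m : ℝ := (2 * n + 1 : ℝ) with hm
  -- `u = |m| / nτ ∈ [1/nτ, 1 - 1/nτ]`
  have key : 2 * (1 / (nτ : ℝ)) ≤ Real.sin (Real.pi * (|m| / nτ)) := by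
    apply two_mul_le_sin_pi_mul_of_mem (by positivity)
    · rw [div_le_div_iff_of_pos_right hnpos]; exact h1
    · rw [le_sub_iff_add_le, ← add_div, div_le_one hnpos]; linarith
  have key' : 2 / (nτ : ℝ) ≤ Real.sin (Real.pi * (|m| / nτ)) := by
    simpa [one_div, div_eq_mul_inv] using key
  have hnn : 0 ≤ Real.sin (Real.pi * (|m| / nτ)) := le_trans (by positivity) key'
  have habs : |Real.sin (Real.pi * m / nτ)| = Real.sin (Real.pi * (|m| / nτ)) := by
    rcases le_or_gt 0 m with h | h
    · rw [abs_of_nonneg h, mul_div_assoc]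
      rw [abs_of_nonneg h] at hnn
      exact abs_of_nonneg hnn
    · rw [abs_of_neg h] at hnn ⊢
      rw [show Real.pi * m / nτ = -(Real.pi * (-m / nτ)) by ring, Real.sin_neg, abs_neg]
      exact abs_of_nonneg hnn
  rw [habs]
  exact key'

/-- **`|iω̂ - E(𝐤)| ≥ |Re ω̂| ≥ 2/β`** for every `ω ∈ 𝕄_{n_τ}` and every `𝐤`.
[cite: Salmhofer1998, Proposition 4 proof (p.18 L83)] -/
theorem two_div_beta_le_norm_propDenom (M : ModelData d) {β : ℝ} (hβ : 0 < β) {nτ : ℕ}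
    (hpos : 0 < nτ) {n : ℤ} (hn : n ∈ matsIdx nτ) (k : Mom d) :
    2 / β ≤ ‖propDenom M β nτ (matsFreq β n) k‖ := by
  have hετ := epsTau_pos hβ hpos
  refine le_trans ?_ (abs_sin_div_le_norm_propDenom M hετ _ k)
  rw [epsTau_mul_matsFreq hβ.ne']
  have hs := two_div_le_abs_sin hpos hn
  rw [le_div_iff₀ hετ]
  have hnpos : (0 : ℝ) < nτ := by exact_mod_cast hpos
  calc 2 / β * epsTau β nτ = 2 / (nτ : ℝ) := by unfold epsTau; field_simp
    _ ≤ _ := hs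


/-! ### Lemma 9 (appendix, TeX `LemA1`) -/

/-- `|sin y| = sin |y|` for `|y| ≤ π`. [cite: Salmhofer1998, Lemma 9 (appendix, TeX LemA1) proof (p.28 L70–72)] -/
theorem abs_sin_eq_sin_abs {y : ℝ} (hy : |y| ≤ Real.pi) : |Real.sin y| = Real.sin |y| := by
  rcases le_or_gt 0 y with h | h
  · rw [abs_of_nonneg h] at hy ⊢
    exact abs_of_nonneg (Real.sin_nonneg_of_nonneg_of_le_pi h hy)
  · rw [abs_of_neg h] at hy ⊢
    have h0 : 0 ≤ Real.sin (-y) := Real.sin_nonneg_of_nonneg_of_le_pi (by linarith) hy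
    rw [Real.sin_neg] at h0 ⊢
    exact abs_of_nonpos (by linarith)

/-- `cos y ≥ 1/2` and `|y| ≤ π` force `|y| ≤ π/3` (the printed proof obtains `|ωε_τ| ≤ π/2` from
`1 - cos x ≥ (2/π²)x²`; the monotonicity of `cos` on `[0, π]` gives the same conclusion). [cite: Salmhofer1998, Lemma 9 (appendix, TeX LemA1) proof (p.28 L65–70)] -/
theorem abs_le_pi_div_three_of_half_le_cos {y : ℝ} (hy : |y| ≤ Real.pi) (hc : 1 / 2 ≤ Real.cos y) :
    |y| ≤ Real.pi / 3 := by
  by_contra h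
  push Not at h
  have h1 : Real.cos |y| < Real.cos (Real.pi / 3) :=
    Real.cos_lt_cos_of_nonneg_of_le_pi (by positivity) hy h
  rw [Real.cos_abs, Real.cos_pi_div_three] at h1
  linarith

/-- The angle of a Matsubara frequency lies in `[-π, π]`: `|ε_τ ω_n| ≤ π` for `n ∈ matsIdx n_τ`.
[cite: Salmhofer1998, §2.2 (p.6 L75–79)] -/
theorem abs_epsTau_mul_matsFreq_le {β : ℝ} (hβ : β ≠ 0) {nτ : ℕ} (hpos : 0 < nτ) {n : ℤ}
    (hn : n ∈ matsIdx nτ) : |epsTau β nτ * matsFreq β n| ≤ Real.pi := by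
  rw [epsTau_mul_matsFreq hβ]
  have hnpos : (0 : ℝ) < nτ := by exact_mod_cast hpos
  obtain ⟨-, h2⟩ := abs_two_mul_add_one_le hn
  rw [abs_div, abs_mul, abs_of_pos Real.pi_pos, abs_of_pos hnpos, div_le_iff₀ hnpos]
  nlinarith [Real.pi_pos]

/-- `|ω_n| = (π/β)|2n+1|`. [cite: Salmhofer1998, §2.2 (p.6 L75–79)] -/
theorem abs_matsFreq {β : ℝ} (hβ : 0 < β) (n : ℤ) :
    |matsFreq β n| = Real.pi / β * |(2 * n + 1 : ℝ)| := by
  unfold matsFreq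
  rw [abs_mul, abs_of_pos (div_pos Real.pi_pos hβ)]

/-- **Lemma 9 (appendix; TeX `LemA1`), pointwise half.**  Let `β > 0`, `E₀ ≥ 0`,
`n_τ ≥ 2β(E₀ + E_max)` with `|E| ≤ E_max`.  Then for all `𝐤` and all `ω ∈ 𝕄_{n_τ}`:
`|iω̂ - E(𝐤)| ≤ E₀` implies `|ω| ≤ (π/2) E₀` and `|E(𝐤)| ≤ 2E₀`.  Proof as printed: `|Re ω̂| ≤ E₀`,
`|Im ω̂ + E| ≤ E₀`, hence `1 - cos(ωε_τ) ≤ ε_τ(E₀ + E_max) ≤ 1/2`, so `|ωε_τ| ≤ π/2` and Jordan's inequality gives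
`|ω| ≤ (π/2)|Re ω̂| ≤ (π/2)E₀`; then `|Im ω̂| ≤ ε_τω²/2 ≤ (π²/8) β E₀²/n_τ ≤ E₀`, so `|E| ≤ 2E₀`.
[cite: Salmhofer1998, Lemma 9 (appendix, TeX LemA1) (p.28 L45–57), proof p.28 L59–84] -/
theorem lemma9_pointwise (M : ModelData d) {β E₀ Emax : ℝ} {nτ : ℕ} (hβ : 0 < β) (hE₀ : 0 ≤ E₀)
    (hEmax : ∀ p, |M.E p| ≤ Emax) (hnτ : 2 * β * (E₀ + Emax) ≤ nτ) (hpos : 0 < nτ)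
    {n : ℤ} (hn : n ∈ matsIdx nτ) (k : Mom d)
    (hle : ‖propDenom M β nτ (matsFreq β n) k‖ ≤ E₀) :
    |matsFreq β n| ≤ Real.pi / 2 * E₀ ∧ |M.E k| ≤ 2 * E₀ := by
  have hετ := epsTau_pos hβ hpos
  have hnpos : (0 : ℝ) < nτ := by exact_mod_cast hpos
  have hπ := Real.pi_pos
  set ετ := epsTau β nτ with hετdef
  set ω := matsFreq β n with hωdef
  set y := ετ * ω with hydef
  have hEmax0 : 0 ≤ Emax := le_trans (abs_nonneg _) (hEmax k)
  have hyπ : |y| ≤ Real.pi := abs_epsTau_mul_matsFreq_le hβ.ne' hpos hn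
  -- the two coordinate bounds
  have hsin : |Real.sin y| / ετ ≤ E₀ := le_trans (abs_sin_div_le_norm_propDenom M hετ ω k) hle
  have hre : |(1 - Real.cos y) / ετ + M.E k| ≤ E₀ :=
    le_trans (abs_re_le_norm_propDenom M hετ.ne' ω k) hle
  -- `(1 - cos y)/ε_τ ≤ E₀ + E_max`
  have hcos0 : 0 ≤ 1 - Real.cos y := by linarith [Real.cos_le_one y]
  have hdiv0 : 0 ≤ (1 - Real.cos y) / ετ := div_nonneg hcos0 hετ.le
  have h1 : (1 - Real.cos y) / ετ ≤ E₀ + Emax := by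
    have := (abs_le.mp hre).2
    have hE := (abs_le.mp (hEmax k)).1
    linarith
  -- `ε_τ (E₀ + E_max) ≤ 1/2`
  have hετval : ετ = β / nτ := rfl
  have h2 : ετ * (E₀ + Emax) ≤ 1 / 2 := by
    rw [hετval, div_mul_eq_mul_div, div_le_iff₀ hnpos]
    linarith
  have h2' : ετ * E₀ ≤ 1 / 2 := by nlinarith
  -- `cos y ≥ 1/2`, hence `|y| ≤ π/3 ≤ π/2`
  have h3 : 1 - Real.cos y ≤ 1 / 2 := by
    have := mul_le_mul_of_nonneg_left h1 hετ.le
    rw [mul_div_cancel₀ _ hετ.ne'] at this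
    linarith
  have h4 : |y| ≤ Real.pi / 3 := abs_le_pi_div_three_of_half_le_cos hyπ (by linarith)
  -- Jordan: `(2/π)|y| ≤ |sin y|`
  have h5 : 2 / Real.pi * |y| ≤ |Real.sin y| := by
    rw [abs_sin_eq_sin_abs hyπ]
    exact Real.mul_le_sin (abs_nonneg y) (by linarith)
  -- `|ω| ≤ (π/2) E₀`
  have hyabs : |y| = ετ * |ω| := by rw [hydef, abs_mul, abs_of_pos hετ]
  have h6' : 2 / Real.pi * |ω| ≤ E₀ := by
    have hh : 2 / Real.pi * |y| / ετ ≤ E₀ := le_trans (div_le_div_of_nonneg_right h5 hετ.le) hsin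
    rw [hyabs] at hh
    calc 2 / Real.pi * |ω| = 2 / Real.pi * (ετ * |ω|) / ετ := by field_simp
      _ ≤ E₀ := hh
  have h6 : |ω| ≤ Real.pi / 2 * E₀ := by
    have := mul_le_mul_of_nonneg_left h6' (le_of_lt (by positivity : (0 : ℝ) < Real.pi / 2))
    calc |ω| = Real.pi / 2 * (2 / Real.pi * |ω|) := by field_simp
      _ ≤ Real.pi / 2 * E₀ := this
  refine ⟨h6, ?_⟩
  -- `(1 - cos y)/ε_τ ≤ ε_τ ω²/2 ≤ (β/n_τ)(π²/8) E₀² ≤ E₀`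
  have hc : 1 - Real.cos y ≤ y ^ 2 / 2 := by linarith [Real.one_sub_sq_div_two_le_cos (x := y)]
  have hyle : |y| ≤ ετ * (Real.pi / 2 * E₀) := by
    rw [hyabs]; exact mul_le_mul_of_nonneg_left h6 hετ.le
  have hy2 : y ^ 2 ≤ (ετ * (Real.pi / 2 * E₀)) ^ 2 := by
    rw [← sq_abs]; exact pow_le_pow_left₀ (abs_nonneg y) hyle 2
  have h7 : (1 - Real.cos y) / ετ ≤ E₀ := by
    rw [div_le_iff₀ hετ]
    have hπ4 := Real.pi_le_four
    have hA : (ετ * (Real.pi / 2 * E₀)) ^ 2 / 2 ≤ 2 * (ετ * E₀) ^ 2 := by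
      have : (Real.pi / 2) ^ 2 ≤ 4 := by nlinarith
      calc (ετ * (Real.pi / 2 * E₀)) ^ 2 / 2 = (Real.pi / 2) ^ 2 / 2 * (ετ * E₀) ^ 2 := by ring
        _ ≤ 4 / 2 * (ετ * E₀) ^ 2 := by gcongr
        _ = 2 * (ετ * E₀) ^ 2 := by ring
    have hB : 2 * (ετ * E₀) ^ 2 ≤ E₀ * ετ := by
      have hx0 : 0 ≤ ετ * E₀ := mul_nonneg hετ.le hE₀
      nlinarith
    linarith
  rw [abs_le]
  obtain ⟨hl, hu⟩ := abs_le.mp hre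
  constructor <;> linarith

/-- Counting integers: a nonempty finite set of integers `n` with `|2n+1| ≤ R` has at most `R + 1`
elements (the count behind `β⁻¹ Σ_n 1(|2n+1| ≤ βE₀/2) ≤ E₀`). [cite: Salmhofer1998, Lemma 9 (appendix, TeX LemA1) proof (p.28 L85–96)] -/
theorem card_le_of_abs_two_mul_add_one_le (S : Finset ℤ) (hS : S.Nonempty) {R : ℝ}
    (h : ∀ n ∈ S, |(2 * n + 1 : ℝ)| ≤ R) : (S.card : ℝ) ≤ R + 1 := by
  set a := S.min' hS with ha
  set b := S.max' hS with hb
  have hsub : S ⊆ Finset.Icc a b := fun n hn =>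
    Finset.mem_Icc.mpr ⟨S.min'_le n hn, S.le_max' n hn⟩
  have hab : a ≤ b := S.min'_le b (S.max'_mem hS)
  have hcard := Finset.card_le_card hsub
  rw [Int.card_Icc] at hcard
  have haR := (abs_le.mp (h a (S.min'_mem hS))).1
  have hbR := (abs_le.mp (h b (S.max'_mem hS))).2
  have h1 : (S.card : ℝ) ≤ (((b + 1 - a).toNat : ℕ) : ℝ) := by exact_mod_cast hcard
  have h2 : (((b + 1 - a).toNat : ℕ) : ℝ) = ((b + 1 - a : ℤ) : ℝ) := by
    rw [← Int.cast_natCast, Int.toNat_of_nonneg (by omega)]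
  rw [h2] at h1
  push_cast at h1
  linarith

/-- **Lemma 9 (appendix; TeX `LemA1`), counting half.**  Under the same hypotheses,
`β⁻¹ Σ_{ω ∈ 𝕄_{n_τ}} 1(|iω̂ - E(𝐤)| ≤ E₀) ≤ E₀ 1(|E(𝐤)| ≤ 2E₀)` ("the last inequality holds in particular if
`βE₀/2 < 1`, because then the sum is empty").
[cite: Salmhofer1998, Lemma 9 (appendix, TeX LemA1) (p.28 L52–57), proof p.28 L78–96] -/
theorem lemma9_sum (M : ModelData d) {β E₀ Emax : ℝ} {nτ : ℕ} (hβ : 0 < β) (hE₀ : 0 ≤ E₀)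
    (hEmax : ∀ p, |M.E p| ≤ Emax) (hnτ : 2 * β * (E₀ + Emax) ≤ nτ) (hpos : 0 < nτ) (k : Mom d) :
    β⁻¹ * ∑ n ∈ matsIdx nτ, (if ‖propDenom M β nτ (matsFreq β n) k‖ ≤ E₀ then (1 : ℝ) else 0)
      ≤ E₀ * (if |M.E k| ≤ 2 * E₀ then (1 : ℝ) else 0) := by
  by_cases hex : ∃ n ∈ matsIdx nτ, ‖propDenom M β nτ (matsFreq β n) k‖ ≤ E₀
  · obtain ⟨n₀, hn₀, hle₀⟩ := hex
    have hE : |M.E k| ≤ 2 * E₀ := (lemma9_pointwise M hβ hE₀ hEmax hnτ hpos hn₀ k hle₀).2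
    rw [if_pos hE, mul_one, Finset.sum_boole]
    set S := (matsIdx nτ).filter (fun n => ‖propDenom M β nτ (matsFreq β n) k‖ ≤ E₀) with hS
    -- every `n ∈ S` has `|2n+1| ≤ βE₀/2`
    have hmem : ∀ n ∈ S, |(2 * n + 1 : ℝ)| ≤ β * E₀ / 2 := by
      intro n hn
      rw [hS, Finset.mem_filter] at hn
      have hω := (lemma9_pointwise M hβ hE₀ hEmax hnτ hpos hn.1 k hn.2).1
      rw [abs_matsFreq hβ] at hω
      rw [le_div_iff₀ (by norm_num : (0:ℝ) < 2)]
      have := mul_le_mul_of_nonneg_left hω hβ.le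
      have hh : β * (Real.pi / β * |(2 * n + 1 : ℝ)|) = Real.pi * |(2 * n + 1 : ℝ)| := by
        field_simp
      rw [hh] at this
      nlinarith [Real.pi_gt_three, abs_nonneg (2 * (n : ℝ) + 1)]
    have hn₀S : n₀ ∈ S := by rw [hS, Finset.mem_filter]; exact ⟨hn₀, hle₀⟩
    have hR1 : 1 ≤ β * E₀ / 2 := le_trans (abs_two_mul_add_one_le hn₀).1 (hmem n₀ hn₀S)
    have hcard : (S.card : ℝ) ≤ β * E₀ / 2 + 1 :=
      card_le_of_abs_two_mul_add_one_le S ⟨n₀, hn₀S⟩ hmem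
    have hcard' : (S.card : ℝ) ≤ β * E₀ := by linarith
    calc β⁻¹ * (S.card : ℝ) ≤ β⁻¹ * (β * E₀) := by gcongr
      _ = E₀ := by field_simp
  · push Not at hex
    have h0 : ∑ n ∈ matsIdx nτ, (if ‖propDenom M β nτ (matsFreq β n) k‖ ≤ E₀ then (1 : ℝ) else 0)
        = 0 := Finset.sum_eq_zero (fun n hn => if_neg (not_le.mpr (hex n hn)))
    rw [h0, mul_zero]
    positivity

/-! ### Calculus of `t ↦ χ₁(A e^{2t}) / c` -/

/-- `ε_t⁻² K = (K/ε₀²) e^{2t}` ((5.8): `ε_t = ε₀ e^{-t}`). [cite: Salmhofer1998, §5.2 (5.8) (p.18 L19–25)] -/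
theorem epsT_inv_sq_mul {eps0 : ℝ} (h0 : eps0 ≠ 0) (K s : ℝ) :
    (epsT eps0 s)⁻¹ ^ 2 * K = K / eps0 ^ 2 * Real.exp (2 * s) := by
  unfold epsT
  have hexp : Real.exp (2 * s) = Real.exp s ^ 2 := by
    rw [← Real.exp_nat_mul]; norm_num
  rw [hexp, mul_inv, Real.exp_neg, inv_inv]
  field_simp

/-- The argument `A e^{2t}` of `χ₁` in (5.9) has `t`-derivative `2 A e^{2t}`. [cite: Salmhofer1998, Proposition 4 proof (p.18 L85–87)] -/
theorem hasDerivAt_arg (A s : ℝ) :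
    HasDerivAt (fun s : ℝ => A * Real.exp (2 * s)) (2 * (A * Real.exp (2 * s))) s := by
  have h := (((hasDerivAt_id s).const_mul (2 : ℝ)).exp).const_mul A
  refine h.congr_deriv ?_
  simp only [id]; ring

/-- `t ↦ A e^{2t}` is smooth. [cite: Salmhofer1998, Proposition 4 proof (p.18 L85–87)] -/
theorem contDiff_arg (A : ℝ) {m : WithTop ℕ∞} :
    ContDiff ℝ m (fun s : ℝ => A * Real.exp (2 * s)) :=
  contDiff_const.mul (Real.contDiff_exp.comp (contDiff_const.mul contDiff_id))

/-- A cutoff function `χ₁ ∈ C^∞(ℝ₀⁺, [0,1])` is differentiable at every `x > 0`.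
[cite: Salmhofer1998, §4.1 (p.15 L125–134)] -/
theorem IsCutoff.hasDerivAt {χ₁ : ℝ → ℝ} (hχ : IsCutoff χ₁) {x : ℝ} (hx : 0 < x) :
    HasDerivAt χ₁ (deriv χ₁ x) x := by
  have h1 : ContDiffAt ℝ ((⊤ : ℕ∞) : WithTop ℕ∞) χ₁ x := hχ.smooth.contDiffAt (Ici_mem_nhds hx)
  exact (h1.differentiableAt (by simp)).hasDerivAt

/-- A cutoff function vanishes on `[1, ∞)`, so `χ₁' = 0` on `(1, ∞)` ("`χ₁'(x) = 0` for `x ∉ (1/4, 1)`").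
[cite: Salmhofer1998, §4.1 (p.15 L125–134); Proposition 4 proof (p.18 L88–89)] -/
theorem IsCutoff.deriv_eq_zero_of_one_lt {χ₁ : ℝ → ℝ} (hχ : IsCutoff χ₁) {x : ℝ} (hx : 1 < x) :
    deriv χ₁ x = 0 := by
  have h : χ₁ =ᶠ[𝓝 x] fun _ => (0 : ℝ) := by
    filter_upwards [Ioi_mem_nhds hx] with z hz
    exact hχ.eq_zero z (le_of_lt hz)
  rw [h.deriv_eq, deriv_const]

/-- The `t`-derivative of `χ₁(A e^{2t})/c` for `A > 0`: `χ₁'(A e^{2t}) · 2A e^{2t} / c` ("the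
`t`-derivative gives `|∂_t C_t(k)| = 2ε_t⁻²|iω̂ - E| |χ₁'(ε_t⁻²|iω̂ - E|²)|`"). [cite: Salmhofer1998, Proposition 4 proof (p.18 L85–87)] -/
theorem hasDerivAt_cutoffComp {χ₁ : ℝ → ℝ} (hχ : IsCutoff χ₁) {A : ℝ} (hA : 0 < A) (c : ℂ) (s : ℝ) :
    HasDerivAt (fun s : ℝ => ((χ₁ (A * Real.exp (2 * s)) : ℝ) : ℂ) / c)
      ((((deriv χ₁ (A * Real.exp (2 * s))) * (2 * (A * Real.exp (2 * s))) : ℝ) : ℂ) / c) s := by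
  have hx : 0 < A * Real.exp (2 * s) := mul_pos hA (Real.exp_pos _)
  have h1 : HasDerivAt (fun s : ℝ => χ₁ (A * Real.exp (2 * s)))
      (deriv χ₁ (A * Real.exp (2 * s)) * (2 * (A * Real.exp (2 * s)))) s :=
    (hχ.hasDerivAt hx).comp s (hasDerivAt_arg A s)
  exact h1.ofReal_comp.div_const c

/-- Smoothness in `t` of `χ₁(A e^{2t})/c` for `A ≥ 0` ("`C_t` is a `C^∞` function of `t`").
[cite: Salmhofer1998, Proposition 4 (p.18 L45–46)] -/
theorem contDiff_cutoffComp {χ₁ : ℝ → ℝ} (hχ : IsCutoff χ₁) {A : ℝ} (hA : 0 ≤ A) (c : ℂ) :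
    ContDiff ℝ ((⊤ : ℕ∞) : WithTop ℕ∞) (fun s : ℝ => ((χ₁ (A * Real.exp (2 * s)) : ℝ) : ℂ) / c) := by
  rcases hA.eq_or_lt with h | h
  · subst h
    simp only [zero_mul]
    exact contDiff_const
  · apply ContDiff.div_const
    have h2 : ContDiff ℝ ((⊤ : ℕ∞) : WithTop ℕ∞) (fun s : ℝ => χ₁ (A * Real.exp (2 * s))) := by
      rw [contDiff_iff_contDiffAt]
      intro s
      have hx : 0 < A * Real.exp (2 * s) := mul_pos h (Real.exp_pos _)
      have hχat : ContDiffAt ℝ ((⊤ : ℕ∞) : WithTop ℕ∞) χ₁ (A * Real.exp (2 * s)) :=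
        hχ.smooth.contDiffAt (Ici_mem_nhds hx)
      exact hχat.comp s (contDiff_arg A).contDiffAt
    exact Complex.ofRealCLM.contDiff.comp h2

/-- If `A e^{2t} > 1` the function `s ↦ χ₁(A e^{2s})/c` vanishes near `t`, so its derivative at `t` is `0`.
[cite: Salmhofer1998, Proposition 4 proof (p.18 L88–91)] -/
theorem deriv_cutoffComp_eq_zero_of_one_lt {χ₁ : ℝ → ℝ} (hχ : IsCutoff χ₁) {A : ℝ} (c : ℂ) {t : ℝ}
    (ht : 1 < A * Real.exp (2 * t)) :
    deriv (fun s : ℝ => ((χ₁ (A * Real.exp (2 * s)) : ℝ) : ℂ) / c) t = 0 := by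
  have hev : ∀ᶠ s in 𝓝 t, 1 < A * Real.exp (2 * s) :=
    (contDiff_arg A (m := 0)).continuous.continuousAt.eventually_const_lt ht
  have h : (fun s : ℝ => ((χ₁ (A * Real.exp (2 * s)) : ℝ) : ℂ) / c) =ᶠ[𝓝 t] fun _ => (0 : ℂ) := by
    filter_upwards [hev] with s hs
    rw [hχ.eq_zero _ (le_of_lt hs)]; simp
  rw [h.deriv_eq, deriv_const]

/-- If `0 ≤ A e^{2t} < 1/4` the function `s ↦ χ₁(A e^{2s})/c` is constant `= 1/c` near `t`, so its
derivative at `t` is `0`. [cite: Salmhofer1998, Proposition 4 proof (p.18 L88–91)] -/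
theorem deriv_cutoffComp_eq_zero_of_lt_quarter {χ₁ : ℝ → ℝ} (hχ : IsCutoff χ₁) {A : ℝ} (hA : 0 ≤ A)
    (c : ℂ) {t : ℝ} (ht : A * Real.exp (2 * t) < 1 / 4) :
    deriv (fun s : ℝ => ((χ₁ (A * Real.exp (2 * s)) : ℝ) : ℂ) / c) t = 0 := by
  have hev : ∀ᶠ s in 𝓝 t, A * Real.exp (2 * s) < 1 / 4 :=
    (contDiff_arg A (m := 0)).continuous.continuousAt.eventually_lt_const ht
  have h : (fun s : ℝ => ((χ₁ (A * Real.exp (2 * s)) : ℝ) : ℂ) / c) =ᶠ[𝓝 t]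
      fun _ => ((1 : ℝ) : ℂ) / c := by
    filter_upwards [hev] with s hs
    rw [hχ.eq_one _ (mul_nonneg hA (Real.exp_pos _).le) (le_of_lt hs)]
  rw [h.deriv_eq, deriv_const]


/-! ### The propagator (5.9) as `χ₁(A e^{2t})/(iω̂ - E)`: supports and pointwise bounds -/

section Pointwise

variable (M : ModelData d) (χ₁ : ℝ → ℝ) (β : ℝ) (nτ : ℕ)

/-- (5.9) rewritten: `D̂_t(k) = χ₁((|iω̂-E|²/ε₀²) e^{2t}) / (iω̂ - E)`. [cite: Salmhofer1998, §5.2 (5.9) (p.18 L27–36)] -/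
theorem cutoffCov_eq (h0 : M.eps0 ≠ 0) (s ω : ℝ) (k : Mom d) :
    cutoffCov M χ₁ β nτ s ω k =
      ((χ₁ (‖propDenom M β nτ ω k‖ ^ 2 / M.eps0 ^ 2 * Real.exp (2 * s)) : ℝ) : ℂ) /
        propDenom M β nτ ω k := by
  unfold cutoffCov
  rw [epsT_inv_sq_mul h0]

/-- (5.9) as an identity of functions of `t`. [cite: Salmhofer1998, §5.2 (5.9) (p.18 L27–36)] -/
theorem cutoffCov_fun_eq (h0 : M.eps0 ≠ 0) (ω : ℝ) (k : Mom d) :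
    (fun s : ℝ => cutoffCov M χ₁ β nτ s ω k) = fun s : ℝ =>
      ((χ₁ (‖propDenom M β nτ ω k‖ ^ 2 / M.eps0 ^ 2 * Real.exp (2 * s)) : ℝ) : ℂ) /
        propDenom M β nτ ω k := by
  funext s; exact cutoffCov_eq M χ₁ β nτ h0 s ω k

/-- The argument of `χ₁` in (5.9) is `(|iω̂ - E|/ε_t)²`. [cite: Salmhofer1998, §5.2 (5.9) (p.18 L27–36)] -/
theorem arg_eq_sq (h0 : M.eps0 ≠ 0) (t ω : ℝ) (k : Mom d) :
    ‖propDenom M β nτ ω k‖ ^ 2 / M.eps0 ^ 2 * Real.exp (2 * t) =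
      (‖propDenom M β nτ ω k‖ / epsT M.eps0 t) ^ 2 := by
  rw [← epsT_inv_sq_mul h0]; ring

variable {M χ₁ β nτ}

/-- First support statement: `D̂_t(k) ≠ 0 ⇒ |iω̂ - E(𝐤)| < ε_t` ("`χ₁(x) = 0` if `x ≥ 1`, so `C_t(k) ≠ 0`
implies `|iω̂ - E(𝐤)| ≤ ε_t`"). [cite: Salmhofer1998, Proposition 4 proof (p.18 L79–80)] -/
theorem norm_lt_of_cutoffCov_ne_zero (h0 : 0 < M.eps0) (hχ : IsCutoff χ₁) {t ω : ℝ} {k : Mom d}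
    (h : cutoffCov M χ₁ β nτ t ω k ≠ 0) : ‖propDenom M β nτ ω k‖ < epsT M.eps0 t := by
  by_contra hle
  push Not at hle
  apply h
  rw [cutoffCov_eq M χ₁ β nτ h0.ne', arg_eq_sq M β nτ h0.ne']
  have hεt := epsT_pos h0 t
  have h1 : 1 ≤ ‖propDenom M β nτ ω k‖ / epsT M.eps0 t := by
    rw [le_div_iff₀ hεt]; linarith
  have h2 : (1 : ℝ) ≤ (‖propDenom M β nτ ω k‖ / epsT M.eps0 t) ^ 2 := one_le_pow₀ h1
  rw [hχ.eq_zero _ h2]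
  simp

/-- `|D̂_t(k)| ≤ 1(|iω̂ - E| ≤ ε_t) / |iω̂ - E|` (`0 ≤ χ₁ ≤ 1` and the support). [cite: Salmhofer1998, Proposition 4 proof (p.18 L79–83)] -/
theorem norm_cutoffCov_le (h0 : 0 < M.eps0) (hχ : IsCutoff χ₁) (t ω : ℝ) (k : Mom d) :
    ‖cutoffCov M χ₁ β nτ t ω k‖ ≤ shellInd M β nτ t ω k / ‖propDenom M β nτ ω k‖ := by
  unfold shellInd
  split_ifs with hle
  · rw [cutoffCov_eq M χ₁ β nτ h0.ne', norm_div, Complex.norm_real, Real.norm_eq_abs]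
    apply div_le_div_of_nonneg_right _ (norm_nonneg _)
    have hx : 0 ≤ ‖propDenom M β nτ ω k‖ ^ 2 / M.eps0 ^ 2 * Real.exp (2 * t) := by positivity
    obtain ⟨h1, h2⟩ := hχ.mem_Icc _ hx
    rw [abs_of_nonneg h1]; exact h2
  · have : cutoffCov M χ₁ β nτ t ω k = 0 := by
      by_contra hne
      exact hle (norm_lt_of_cutoffCov_ne_zero h0 hχ hne).le
    rw [this, norm_zero]
    positivity

/-- Second support statement: `Ḋ̂_t(k) ≠ 0 ⇒ ε_t/2 ≤ |iω̂ - E| ≤ ε_t` ("since `χ₁'(x) = 0` for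
`x ∉ (1/4, 1)`": otherwise `s ↦ D̂_s(k)` is locally constant near `t`). [cite: Salmhofer1998, Proposition 4 proof (p.18 L88–91)] -/
theorem shell_of_cutoffCovDot_ne_zero (h0 : 0 < M.eps0) (hχ : IsCutoff χ₁) {t ω : ℝ} {k : Mom d}
    (h : cutoffCovDot M χ₁ β nτ t ω k ≠ 0) :
    epsT M.eps0 t / 2 ≤ ‖propDenom M β nτ ω k‖ ∧ ‖propDenom M β nτ ω k‖ ≤ epsT M.eps0 t := by
  unfold cutoffCovDot at h
  rw [cutoffCov_fun_eq M χ₁ β nτ h0.ne'] at h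
  have hεt := epsT_pos h0 t
  set ρ := ‖propDenom M β nτ ω k‖ / epsT M.eps0 t with hρ
  have hρ0 : 0 ≤ ρ := div_nonneg (norm_nonneg _) hεt.le
  have hA : 0 ≤ ‖propDenom M β nτ ω k‖ ^ 2 / M.eps0 ^ 2 := by positivity
  constructor
  · by_contra hlt
    push Not at hlt
    apply h
    apply deriv_cutoffComp_eq_zero_of_lt_quarter hχ hA
    rw [arg_eq_sq M β nτ h0.ne']
    have hρlt : ρ < 1 / 2 := by rw [hρ, div_lt_iff₀ hεt]; linarith
    nlinarith
  · by_contra hlt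
    push Not at hlt
    apply h
    apply deriv_cutoffComp_eq_zero_of_one_lt hχ
    rw [arg_eq_sq M β nτ h0.ne']
    have hρgt : 1 < ρ := by rw [hρ, lt_div_iff₀ hεt]; linarith
    nlinarith

/-- First pointwise bound: `|Ḋ̂_t(k)| ≤ 4 ε_t⁻¹ 1(|iω̂ - E| ≤ ε_t)` (`|∂_t C_t| = 2ε_t⁻²|iω̂ - E| |χ₁'|`,
`|χ₁'| ≤ 2`, and the support). [cite: Salmhofer1998, Proposition 4 (p.18 L58–63), proof p.18 L85–91] -/
theorem norm_cutoffCovDot_le (h0 : 0 < M.eps0) (hχ : IsCutoff χ₁) (t ω : ℝ) (k : Mom d) :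
    ‖cutoffCovDot M χ₁ β nτ t ω k‖ ≤ 4 * (epsT M.eps0 t)⁻¹ * shellInd M β nτ t ω k := by
  have hεt := epsT_pos h0 t
  unfold shellInd
  split_ifs with hle
  · -- inside the shell: derivative formula
    rw [mul_one]
    unfold cutoffCovDot
    rw [cutoffCov_fun_eq M χ₁ β nτ h0.ne']
    set c := propDenom M β nτ ω k with hc
    set A := ‖c‖ ^ 2 / M.eps0 ^ 2 with hAdef
    rcases eq_or_ne c 0 with hc0 | hc0
    · -- `c = 0`: the function is constant (`x/0 = 0`)
      have : (fun s : ℝ => ((χ₁ (A * Real.exp (2 * s)) : ℝ) : ℂ) / c) = fun _ => (0 : ℂ) := by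
        funext s; rw [hc0, div_zero]
      rw [this, deriv_const, norm_zero]; positivity
    · have hA : 0 < A := by rw [hAdef]; positivity
      rw [(hasDerivAt_cutoffComp hχ hA c t).deriv, norm_div, Complex.norm_real, Real.norm_eq_abs]
      set x := A * Real.exp (2 * t) with hxdef
      have hx : 0 < x := mul_pos hA (Real.exp_pos _)
      have hxeq : x = (‖c‖ / epsT M.eps0 t) ^ 2 := by
        rw [hxdef, hAdef]; exact arg_eq_sq M β nτ h0.ne' t ω k
      have hd : |deriv χ₁ x| ≤ 2 := hχ.deriv_bound x hx
      have hcpos : 0 < ‖c‖ := norm_pos_iff.mpr hc0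
      rw [abs_mul, abs_of_pos (by positivity : 0 < 2 * x), div_le_iff₀ hcpos]
      -- `|χ₁'(x)| · 2x ≤ 2 · 2 (|c|/ε_t)² = 4 |c| (|c|/ε_t²) ≤ (4/ε_t) |c|`
      have h1 : |deriv χ₁ x| * (2 * x) ≤ 2 * (2 * x) :=
        mul_le_mul_of_nonneg_right hd (by positivity)
      have h2 : x ≤ ‖c‖ * (epsT M.eps0 t)⁻¹ := by
        rw [hxeq, div_pow, sq, sq]
        rw [div_le_iff₀ (by positivity)]
        calc ‖c‖ * ‖c‖ = ‖c‖ * (epsT M.eps0 t)⁻¹ * (‖c‖ * epsT M.eps0 t) := by field_simp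
          _ ≤ ‖c‖ * (epsT M.eps0 t)⁻¹ * (epsT M.eps0 t * epsT M.eps0 t) := by
            gcongr
      calc |deriv χ₁ x| * (2 * x) ≤ 2 * (2 * x) := h1
        _ ≤ 2 * (2 * (‖c‖ * (epsT M.eps0 t)⁻¹)) := by gcongr
        _ = 4 * (epsT M.eps0 t)⁻¹ * ‖c‖ := by ring
  · -- outside the shell: the derivative vanishes
    have : cutoffCovDot M χ₁ β nτ t ω k = 0 := by
      by_contra hne
      exact hle (shell_of_cutoffCovDot_ne_zero h0 hχ hne).2
    rw [this, norm_zero]; simp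

/-- Second pointwise bound: `4 ε_t⁻¹ 1(|iω̂ - E| ≤ ε_t) ≤ 2β 1(|iω̂ - E| ≤ ε_t)` whenever `|iω̂ - E| ≥ 2/β`
(on the shell `ε_t ≥ |iω̂ - E| ≥ 2/β`). [cite: Salmhofer1998, Proposition 4 (p.18 L58–63), proof p.18 L83] -/
theorem four_inv_epsT_le_two_beta (h0 : 0 < M.eps0) (hβ : 0 < β) {t ω : ℝ} {k : Mom d}
    (h2β : 2 / β ≤ ‖propDenom M β nτ ω k‖) :
    4 * (epsT M.eps0 t)⁻¹ * shellInd M β nτ t ω k ≤ 2 * β * shellInd M β nτ t ω k := by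
  unfold shellInd
  split_ifs with hle
  · have hεt := epsT_pos h0 t
    rw [mul_one, mul_one]
    have h : 2 / β ≤ epsT M.eps0 t := le_trans h2β hle
    rw [div_le_iff₀ hβ] at h
    calc 4 * (epsT M.eps0 t)⁻¹ = 2 * 2 / epsT M.eps0 t := by ring
      _ ≤ 2 * (epsT M.eps0 t * β) / epsT M.eps0 t := by gcongr
      _ = 2 * β := by field_simp
  · simp

/-- Third pointwise bound: `|D̂_t(k)| ≤ (β/2) 1(|iω̂ - E| ≤ ε_t)` whenever `|iω̂ - E| ≥ 2/β`.
[cite: Salmhofer1998, Proposition 4 (p.18 L65–66), proof p.18 L83] -/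
theorem norm_cutoffCov_le_half_beta (h0 : 0 < M.eps0) (hχ : IsCutoff χ₁) (hβ : 0 < β) {t ω : ℝ}
    {k : Mom d} (h2β : 2 / β ≤ ‖propDenom M β nτ ω k‖) :
    ‖cutoffCov M χ₁ β nτ t ω k‖ ≤ β / 2 * shellInd M β nτ t ω k := by
  refine le_trans (norm_cutoffCov_le h0 hχ t ω k) ?_
  have hc : 0 < ‖propDenom M β nτ ω k‖ := lt_of_lt_of_le (by positivity) h2β
  have hind : 0 ≤ shellInd M β nτ t ω k := by unfold shellInd; split_ifs <;> norm_num
  rw [div_le_iff₀ hc]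
  have : (1 : ℝ) ≤ β / 2 * ‖propDenom M β nτ ω k‖ := by
    rw [div_le_iff₀ hβ] at h2β
    nlinarith
  calc shellInd M β nτ t ω k = shellInd M β nτ t ω k * 1 := by ring
    _ ≤ shellInd M β nτ t ω k * (β / 2 * ‖propDenom M β nτ ω k‖) := by gcongr
    _ = β / 2 * shellInd M β nτ t ω k * ‖propDenom M β nτ ω k‖ := by ring

/-- `D̂_t ≡ 0` for `t > log(βε₀/2)`: on the Matsubara set `|iω̂ - E| ≥ 2/β`, and `2/β > ε_t` there (the
printed proof routes this through Lemma 9: `|ω| ≤ (π/2)ε_t` and `|ω| ≥ π/β`). [cite: Salmhofer1998, Proposition 4 (p.18 L45–46), proof p.18 L79–82] -/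
theorem cutoffCov_eq_zero_of_log_lt (h0 : 0 < M.eps0) (hχ : IsCutoff χ₁) (hβ : 0 < β) {t ω : ℝ}
    {k : Mom d} (h2β : 2 / β ≤ ‖propDenom M β nτ ω k‖) (ht : Real.log (β * M.eps0 / 2) < t) :
    cutoffCov M χ₁ β nτ t ω k = 0 := by
  by_contra hne
  have hlt := lt_of_le_of_lt h2β (norm_lt_of_cutoffCov_ne_zero h0 hχ hne)
  -- `2/β < ε₀ e^{-t}` means `e^t < βε₀/2`, i.e. `t < log(βε₀/2)`
  unfold epsT at hlt
  have hpos : 0 < β * M.eps0 / 2 := by positivity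
  have : t < Real.log (β * M.eps0 / 2) := by
    rw [Real.lt_log_iff_exp_lt hpos]
    rw [div_lt_iff₀ hβ, Real.exp_neg] at hlt
    have hexp := Real.exp_pos t
    rw [lt_div_iff₀ (by norm_num : (0:ℝ) < 2)]
    have := mul_lt_mul_of_pos_right hlt hexp
    calc Real.exp t * 2 = 2 * Real.exp t := by ring
      _ < M.eps0 * (Real.exp t)⁻¹ * β * Real.exp t := this
      _ = β * M.eps0 := by field_simp
  linarith

/-- `t ↦ D̂_t(k)` is `C^∞`. [cite: Salmhofer1998, Proposition 4 (p.18 L45–46)] -/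
theorem contDiff_cutoffCov (h0 : 0 < M.eps0) (hχ : IsCutoff χ₁) (ω : ℝ) (k : Mom d) :
    ContDiff ℝ ((⊤ : ℕ∞) : WithTop ℕ∞) fun t : ℝ => cutoffCov M χ₁ β nτ t ω k := by
  rw [cutoffCov_fun_eq M χ₁ β nτ h0.ne']
  exact contDiff_cutoffComp hχ (by positivity) _

end Pointwise


/-! ### The momentum sums of Proposition 4 -/

section Sums

/-- Fubini for the finite momentum sum: `∫_{Λ*} dk F = L^{-d} Σ_𝐤 (β⁻¹ Σ_ω F(ω, 𝐤))`.
[cite: Salmhofer1998, §2.2 (p.6 L80–83)] -/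
theorem momSum_eq_sum (β latt : ℝ) (nτ L : ℕ) (F : ℝ → Mom d → ℝ) :
    momSum β latt nτ L F = ((L : ℝ) ^ d)⁻¹ * ∑ q : Fin d → Fin L,
      (β⁻¹ * ∑ n ∈ matsIdx nτ, F (matsFreq β n) (latticeMom latt L q)) := by
  simp only [momSum, Finset.mul_sum]
  rw [Finset.sum_comm]
  refine Finset.sum_congr rfl (fun q _ => Finset.sum_congr rfl (fun n _ => by ring))

/-- Monotonicity of `∫_{Λ*} dk` in the integrand (`β > 0`). [cite: Salmhofer1998, §2.2 (p.6 L80–83)] -/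
theorem momSum_mono {β : ℝ} (hβ : 0 < β) (latt : ℝ) (nτ L : ℕ) {F G : ℝ → Mom d → ℝ}
    (h : ∀ n ∈ matsIdx nτ, ∀ q : Fin d → Fin L,
      F (matsFreq β n) (latticeMom latt L q) ≤ G (matsFreq β n) (latticeMom latt L q)) :
    momSum β latt nτ L F ≤ momSum β latt nτ L G := by
  unfold momSum
  apply mul_le_mul_of_nonneg_left _ (inv_nonneg.mpr hβ.le)
  apply Finset.sum_le_sum
  intro n hn
  apply mul_le_mul_of_nonneg_left _ (by positivity)
  exact Finset.sum_le_sum (fun q _ => h n hn q)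

/-- The volume bound `L^{-d} #{𝐤 ∈ Λ_s* : |E(𝐤)| ≤ 2} ≤ V₁` (TeX `Vobou`) as a bound on
`L^{-d} Σ_𝐤 c·1(|E(𝐤)| ≤ 2)`. [cite: Salmhofer1998, Proposition 4 proof (p.18 L93–95, "by Vobou")] -/
theorem density_le (M : ModelData d) {L : ℕ} {V₁ c : ℝ} (hc : 0 ≤ c)
    (hV : ((Finset.univ.filter fun q : Fin d → Fin L => |M.E (latticeMom M.latt L q)| ≤ 2).card : ℝ)
      / (L : ℝ) ^ d ≤ V₁) :
    ((L : ℝ) ^ d)⁻¹ * ∑ q : Fin d → Fin L,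
        c * (if |M.E (latticeMom M.latt L q)| ≤ 2 then (1 : ℝ) else 0) ≤ c * V₁ := by
  rw [← Finset.mul_sum, Finset.sum_boole]
  calc ((L : ℝ) ^ d)⁻¹ * (c * ((Finset.univ.filter
          fun q : Fin d → Fin L => |M.E (latticeMom M.latt L q)| ≤ 2).card : ℝ))
        = c * (((Finset.univ.filter
          fun q : Fin d → Fin L => |M.E (latticeMom M.latt L q)| ≤ 2).card : ℝ) / (L : ℝ) ^ d) := by
        ring
    _ ≤ c * V₁ := mul_le_mul_of_nonneg_left hV hc

/-- Monotonicity of indicator functions (`1(A) ≤ 1(B)` if `A ⇒ B`; "In terms of indicator functions, this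
means …"). [cite: Salmhofer1998, Lemma 9 (appendix, TeX LemA1) proof (p.28 L80–84)] -/
theorem ite_le_ite_of_imp {P Q : Prop} [Decidable P] [Decidable Q] (h : P → Q) :
    (if P then (1 : ℝ) else 0) ≤ if Q then (1 : ℝ) else 0 := by
  by_cases hP : P
  · have hQ := h hP
    simp [hP, hQ]
  · by_cases hQ : Q <;> simp [hP, hQ]

/-- For `t ≥ 0` the standing hypothesis `n_τ ≥ 2β(ε₀ + E_max)` gives `n_τ ≥ 2β(ε_t + E_max)` ("Thus Lemma
(LemA1) applies, with `E₀ = ε_t`, for all `t ≥ 0`"). [cite: Salmhofer1998, §5 (p.17 L37–40)] -/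
theorem ntau_hyp_at_t {eps0 Emax β : ℝ} {nτ : ℕ} (h0 : 0 ≤ eps0) (hβ : 0 ≤ β)
    (hnτ : 2 * β * (eps0 + Emax) ≤ nτ) {t : ℝ} (ht : 0 ≤ t) :
    2 * β * (epsT eps0 t + Emax) ≤ nτ := by
  have := epsT_le h0 ht
  nlinarith

/-- **First integral bound: `∫_{Λ*} dk |Ḋ̂_t(k)| ≤ 4V₁`** — pointwise bound, Lemma 9's counting
`β⁻¹Σ_ω 1(|iω̂ - E| ≤ ε_t) ≤ ε_t 1(|E| ≤ 2ε_t)`, and the volume bound (`2ε_t ≤ 2`).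
[cite: Salmhofer1998, Proposition 4 (p.18 L70–75), proof p.18 L93–95] -/
theorem momSum_norm_cutoffCovDot_le {M : ModelData d} (hM : M.Hyp) {χ₁ : ℝ → ℝ} (hχ : IsCutoff χ₁)
    {Emax V₁ β : ℝ} {nτ L : ℕ} (hEmax : ∀ p, |M.E p| ≤ Emax)
    (hV : ((Finset.univ.filter fun q : Fin d → Fin L => |M.E (latticeMom M.latt L q)| ≤ 2).card : ℝ)
      / (L : ℝ) ^ d ≤ V₁)
    (hβ : 0 < β) (hnpos : 0 < nτ) (hnτ : 2 * β * (M.eps0 + Emax) ≤ nτ) {t : ℝ} (ht : 0 ≤ t) :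
    momSum β M.latt nτ L (fun ω k => ‖cutoffCovDot M χ₁ β nτ t ω k‖) ≤ 4 * V₁ := by
  have h0 := hM.eps0_pos
  have hεt := epsT_pos h0 t
  have hεle : epsT M.eps0 t ≤ M.eps0 := epsT_le h0.le ht
  have hnτ' := ntau_hyp_at_t h0.le hβ.le hnτ ht
  calc momSum β M.latt nτ L (fun ω k => ‖cutoffCovDot M χ₁ β nτ t ω k‖)
      ≤ momSum β M.latt nτ L (fun ω k => 4 * (epsT M.eps0 t)⁻¹ * shellInd M β nτ t ω k) :=
        momSum_mono hβ _ _ _ (fun n _ q => norm_cutoffCovDot_le h0 hχ t _ _)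
    _ = ((L : ℝ) ^ d)⁻¹ * ∑ q : Fin d → Fin L, (β⁻¹ * ∑ n ∈ matsIdx nτ,
          4 * (epsT M.eps0 t)⁻¹ * shellInd M β nτ t (matsFreq β n) (latticeMom M.latt L q)) :=
        momSum_eq_sum _ _ _ _ _
    _ ≤ ((L : ℝ) ^ d)⁻¹ * ∑ q : Fin d → Fin L,
          4 * (if |M.E (latticeMom M.latt L q)| ≤ 2 then (1 : ℝ) else 0) := by
        apply mul_le_mul_of_nonneg_left _ (by positivity)
        apply Finset.sum_le_sum
        intro q _
        set k := latticeMom M.latt L q with hk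
        have h9 := lemma9_sum M hβ hεt.le hEmax hnτ' hnpos k
        have hre : β⁻¹ * ∑ n ∈ matsIdx nτ,
            4 * (epsT M.eps0 t)⁻¹ * shellInd M β nτ t (matsFreq β n) k =
            4 * (epsT M.eps0 t)⁻¹ * (β⁻¹ * ∑ n ∈ matsIdx nτ,
              (if ‖propDenom M β nτ (matsFreq β n) k‖ ≤ epsT M.eps0 t then (1 : ℝ) else 0)) := by
          simp only [shellInd, Finset.mul_sum]
          exact Finset.sum_congr rfl (fun n _ => by ring)
        rw [hre]
        calc 4 * (epsT M.eps0 t)⁻¹ * (β⁻¹ * ∑ n ∈ matsIdx nτ,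
              (if ‖propDenom M β nτ (matsFreq β n) k‖ ≤ epsT M.eps0 t then (1 : ℝ) else 0))
            ≤ 4 * (epsT M.eps0 t)⁻¹ * (epsT M.eps0 t *
                (if |M.E k| ≤ 2 * epsT M.eps0 t then (1 : ℝ) else 0)) :=
              mul_le_mul_of_nonneg_left h9 (by positivity)
          _ = 4 * ((epsT M.eps0 t)⁻¹ * epsT M.eps0 t) *
                (if |M.E k| ≤ 2 * epsT M.eps0 t then (1 : ℝ) else 0) := by ring
          _ = 4 * (if |M.E k| ≤ 2 * epsT M.eps0 t then (1 : ℝ) else 0) := by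
              rw [inv_mul_cancel₀ hεt.ne', mul_one]
          _ ≤ 4 * (if |M.E k| ≤ 2 then (1 : ℝ) else 0) := by
              gcongr
              exact ite_le_ite_of_imp (fun h => h.trans (by linarith [hM.eps0_le_one]))
    _ ≤ 4 * V₁ := density_le M (by norm_num) hV

/-! #### The harmonic bound behind `∫_{Λ*} dk |D̂_t(k)| ≤ V₁ log(βε₀/2)` -/

/-- The chord of the concave function `sin` on `[0, π/4]`: `(2√2/π) y ≤ sin y` — a sharpening of Jordan's
inequality used by this file's route to the second integral bound (see the module docstring).
[cite: Salmhofer1998, Proposition 4 (p.18 L70–75); proof device of this file for the last display] -/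
theorem chord_mul_le_sin {y : ℝ} (h0 : 0 ≤ y) (h1 : y ≤ Real.pi / 4) :
    2 * Real.sqrt 2 / Real.pi * y ≤ Real.sin y := by
  have hπ := Real.pi_pos
  have hcv := strictConcaveOn_sin_Icc.concaveOn
  set b := y / (Real.pi / 4) with hb
  have hb0 : 0 ≤ b := by positivity
  have hb1 : b ≤ 1 := by rw [hb, div_le_one (by positivity)]; exact h1
  have key := hcv.2 (show (0 : ℝ) ∈ Set.Icc 0 Real.pi from ⟨le_refl _, hπ.le⟩)
    (show Real.pi / 4 ∈ Set.Icc 0 Real.pi from ⟨by positivity, by linarith⟩)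
    (show 0 ≤ 1 - b by linarith) hb0 (by ring)
  simp only [smul_eq_mul, Real.sin_zero, mul_zero, zero_add, Real.sin_pi_div_four] at key
  have hy : b * (Real.pi / 4) = y := by rw [hb]; field_simp
  rw [hy] at key
  calc 2 * Real.sqrt 2 / Real.pi * y = b * (Real.sqrt 2 / 2) := by rw [hb]; field_simp; ring
    _ ≤ Real.sin y := key

/-- The odd harmonic sum `Σ_{j ≤ m} 1/(2j+1) ≤ 4/3 + (1/2) log((2m+1)/3)` for `m ≥ 1` (telescoping with
`log x ≥ 1 - 1/x`) — this file's route to the second integral bound (see the module docstring).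
[cite: Salmhofer1998, Proposition 4 (p.18 L70–75); proof device of this file for the last display] -/
theorem odd_harmonic_le_log (m : ℕ) (hm : 1 ≤ m) :
    ∑ j ∈ Finset.range (m + 1), 1 / (2 * (j : ℝ) + 1) ≤
      4 / 3 + 1 / 2 * Real.log ((2 * m + 1) / 3) := by
  induction m, hm using Nat.le_induction with
  | base => norm_num [Finset.sum_range_succ]
  | succ m hm ih =>
    rw [Finset.sum_range_succ]
    push_cast
    have hx : (0 : ℝ) < (2 * m + 3) / (2 * m + 1) := by positivity
    have hlog : 1 - ((2 * (m : ℝ) + 3) / (2 * m + 1))⁻¹ ≤ Real.log ((2 * (m : ℝ) + 3) / (2 * m + 1)) :=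
      Real.one_sub_inv_le_log_of_pos hx
    have hstep : 1 / (2 * ((m : ℝ) + 1) + 1) ≤
        1 / 2 * (Real.log ((2 * ((m : ℝ) + 1) + 1) / 3) - Real.log ((2 * m + 1) / 3)) := by
      rw [← Real.log_div (by positivity) (by positivity)]
      have h1 : (2 * ((m : ℝ) + 1) + 1) / 3 / ((2 * m + 1) / 3) = (2 * m + 3) / (2 * m + 1) := by
        field_simp; ring
      rw [h1]
      have h2 : 1 - ((2 * (m : ℝ) + 3) / (2 * m + 1))⁻¹ = 2 / (2 * m + 3) := by
        field_simp; ring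
      rw [h2] at hlog
      have h3 : 1 / (2 * ((m : ℝ) + 1) + 1) = 1 / 2 * (2 / (2 * m + 3)) := by
        field_simp; ring
      rw [h3]
      gcongr
    linarith

/-- Consequently `Σ_{j ≤ m} 1/(2j+1) ≤ Φ(R) := max 1 (4/3 + (1/2) log(R/3))` whenever `2m+1 ≤ R`.
[cite: Salmhofer1998, Proposition 4 (p.18 L70–75); proof device of this file for the last display] -/
theorem odd_harmonic_le_max (m : ℕ) {R : ℝ} (hR : (2 * m + 1 : ℝ) ≤ R) :
    ∑ j ∈ Finset.range (m + 1), 1 / (2 * (j : ℝ) + 1) ≤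
      max 1 (4 / 3 + 1 / 2 * Real.log (R / 3)) := by
  rcases Nat.eq_zero_or_pos m with h | h
  · subst h; norm_num
  · refine le_trans (odd_harmonic_le_log m h) (le_trans ?_ (le_max_right _ _))
    gcongr

/-- The truncated sum `Σ_{n ∈ Ico 0 N} 1(2n+1 ≤ R)/(2n+1)` over nonnegative integers is `≤ Φ(R)`.
[cite: Salmhofer1998, Proposition 4 (p.18 L70–75); proof device of this file for the last display] -/
theorem sum_Ico_inv_odd_le (N : ℕ) (R : ℝ) :
    ∑ n ∈ Finset.Ico (0 : ℤ) N, (if |(2 * n + 1 : ℝ)| ≤ R then 1 / |(2 * n + 1 : ℝ)| else 0) ≤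
      max 1 (4 / 3 + 1 / 2 * Real.log (R / 3)) := by
  rw [← Finset.sum_filter]
  set F := (Finset.Ico (0 : ℤ) N).filter (fun n : ℤ => |(2 * (n : ℝ) + 1)| ≤ R) with hF
  rcases F.eq_empty_or_nonempty with hE | hne
  · rw [hE, Finset.sum_empty]; exact le_trans zero_le_one (le_max_left _ _)
  · set M₀ := F.max' hne with hM₀
    have hM₀mem : M₀ ∈ F := F.max'_mem hne
    rw [hF, Finset.mem_filter, Finset.mem_Ico] at hM₀mem
    obtain ⟨⟨hM₀0, -⟩, hM₀R⟩ := hM₀mem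
    -- `F ⊆ Ico 0 (M₀+1)`, the summand is nonnegative
    have hsub : F ⊆ Finset.Ico (0 : ℤ) (M₀ + 1) := by
      intro n hn
      have hle := F.le_max' n hn
      rw [hF, Finset.mem_filter, Finset.mem_Ico] at hn
      rw [Finset.mem_Ico]; exact ⟨hn.1.1, by omega⟩
    have h1 : ∑ n ∈ F, 1 / |(2 * n + 1 : ℝ)| ≤ ∑ n ∈ Finset.Ico (0 : ℤ) (M₀ + 1), 1 / |(2 * n + 1 : ℝ)| :=
      Finset.sum_le_sum_of_subset_of_nonneg hsub (fun _ _ _ => by positivity)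
    refine le_trans h1 ?_
    -- reindex by `ℕ`
    set m := M₀.toNat with hm
    have hmM : (m : ℤ) = M₀ := Int.toNat_of_nonneg hM₀0
    have himg : Finset.Ico (0 : ℤ) (M₀ + 1) = (Finset.range (m + 1)).image (fun j : ℕ => (j : ℤ)) := by
      ext n
      simp only [Finset.mem_Ico, Finset.mem_image, Finset.mem_range]
      constructor
      · intro h; exact ⟨n.toNat, by omega, by omega⟩
      · rintro ⟨j, hj, rfl⟩; omega
    rw [himg, Finset.sum_image (fun _ _ _ _ h => by exact_mod_cast h)]
    have h2 : ∑ j ∈ Finset.range (m + 1), 1 / |(2 * ((j : ℕ) : ℤ) + 1 : ℝ)| =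
        ∑ j ∈ Finset.range (m + 1), 1 / (2 * (j : ℝ) + 1) := by
      refine Finset.sum_congr rfl (fun j _ => ?_)
      push_cast
      rw [abs_of_pos (by positivity)]
    rw [h2]
    apply odd_harmonic_le_max
    have : (2 * M₀ + 1 : ℝ) ≤ R := by
      have := hM₀R; rwa [abs_of_nonneg (by positivity)] at this
    rw [← hmM] at this
    exact_mod_cast this

/-- The symmetric sum over the Matsubara index range,
`Σ_{n ∈ Ico(-N, N)} 1(|2n+1| ≤ R)/|2n+1| ≤ 2 Φ(R)`.
[cite: Salmhofer1998, Proposition 4 (p.18 L70–75); proof device of this file for the last display] -/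
theorem sum_inv_odd_le (N : ℕ) (R : ℝ) :
    ∑ n ∈ Finset.Ico (-(N : ℤ)) N, (if |(2 * n + 1 : ℝ)| ≤ R then 1 / |(2 * n + 1 : ℝ)| else 0) ≤
      2 * max 1 (4 / 3 + 1 / 2 * Real.log (R / 3)) := by
  rw [← Finset.Ico_union_Ico_eq_Ico (show (-(N : ℤ)) ≤ 0 by omega) (show (0 : ℤ) ≤ N by omega),
    Finset.sum_union (Finset.Ico_disjoint_Ico_consecutive _ _ _), two_mul]
  gcongr
  · -- negative indices: `n = -1-j`
    have himg : Finset.Ico (-(N : ℤ)) 0 = (Finset.Ico (0 : ℤ) N).image (fun j => -1 - j) := by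
      ext n
      simp only [Finset.mem_Ico, Finset.mem_image]
      constructor
      · intro h; exact ⟨-1 - n, by omega, by omega⟩
      · rintro ⟨j, hj, rfl⟩; omega
    rw [himg, Finset.sum_image (fun _ _ _ _ h => by linarith)]
    have h2 : ∀ j : ℤ, |(2 * ((-1 - j : ℤ) : ℝ) + 1)| = |(2 * j + 1 : ℝ)| := by
      intro j; push_cast
      rw [show (2 * (-1 - (j : ℝ)) + 1) = -(2 * j + 1) by ring, abs_neg]
    simp_rw [h2]
    exact sum_Ico_inv_odd_le N R
  · exact sum_Ico_inv_odd_le N R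

/-- The numerical inequality `Φ(R) ≤ √2 · log(B/2)` for `0 < R ≤ B/2` and `B ≥ 6` (`B = βε₀`; uses
`log 2 > 0.6931`, `log(3/2) ≥ 1/3`, `√2 ≥ 1.414`).
[cite: Salmhofer1998, Proposition 4 (p.18 L70–75); proof device of this file for the last display] -/
theorem max_le_sqrt_two_mul_log {R B : ℝ} (hR0 : 0 < R) (hRB : R ≤ B / 2) (h6 : 6 ≤ B) :
    max 1 (4 / 3 + 1 / 2 * Real.log (R / 3)) ≤ Real.sqrt 2 * Real.log (B / 2) := by
  have hT3 : Real.log 3 ≤ Real.log (B / 2) := Real.log_le_log (by norm_num) (by linarith)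
  have hℓ : (1.026 : ℝ) ≤ Real.log 3 := by
    have h2 := Real.log_two_gt_d9
    have h32 : (1 : ℝ) / 3 ≤ Real.log (3 / 2) := by
      have := Real.one_sub_inv_le_log_of_pos (by norm_num : (0 : ℝ) < 3 / 2)
      norm_num at this ⊢
      linarith
    have : Real.log 3 = Real.log 2 + Real.log (3 / 2) := by
      rw [← Real.log_mul (by norm_num) (by norm_num)]; norm_num
    linarith
  have hs : (1.414 : ℝ) ≤ Real.sqrt 2 := by
    calc (1.414 : ℝ) = Real.sqrt (1.414 ^ 2) := (Real.sqrt_sq (by norm_num)).symm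
      _ ≤ Real.sqrt 2 := Real.sqrt_le_sqrt (by norm_num)
  have hT0 : 0 ≤ Real.log (B / 2) := le_trans (by linarith) hT3
  have hRT : Real.log R ≤ Real.log (B / 2) := Real.log_le_log hR0 hRB
  have hsT : 1.414 * Real.log (B / 2) ≤ Real.sqrt 2 * Real.log (B / 2) :=
    mul_le_mul_of_nonneg_right hs hT0
  apply max_le
  · linarith
  · rw [Real.log_div hR0.ne' (by norm_num)]
    linarith

/-- The per-frequency bound on the shell: for `n ∈ matsIdx n_τ` with `|iω̂_n - E(𝐤)| ≤ ε_t` (`t ≥ 0`):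
`|2n+1| ≤ βε_t/2` (Lemma 9) and `β⁻¹ |iω̂_n - E(𝐤)|⁻¹ ≤ 1/(2√2 |2n+1|)` — from `|iω̂ - E| ≥ |Re ω̂| =
|sin(π(2n+1)/n_τ)|/ε_τ`, `|π(2n+1)/n_τ| ≤ π/4` (as `βε_t/2 ≤ n_τ/4`) and the chord of `sin`.
[cite: Salmhofer1998, Proposition 4 (p.18 L70–75), proof p.18 L80–83; proof device of this file for the last display] -/
theorem per_term_bound {M : ModelData d} (hM : M.Hyp) {Emax β : ℝ} {nτ : ℕ}
    (hEmax : ∀ p, |M.E p| ≤ Emax) (hβ : 0 < β) (hnpos : 0 < nτ)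
    (hnτ : 2 * β * (M.eps0 + Emax) ≤ nτ) {t : ℝ} (ht : 0 ≤ t) {n : ℤ} (hn : n ∈ matsIdx nτ)
    (k : Mom d) (hle : ‖propDenom M β nτ (matsFreq β n) k‖ ≤ epsT M.eps0 t) :
    |(2 * n + 1 : ℝ)| ≤ β * epsT M.eps0 t / 2 ∧
      β⁻¹ * (1 / ‖propDenom M β nτ (matsFreq β n) k‖) ≤
        1 / (2 * Real.sqrt 2) * (1 / |(2 * n + 1 : ℝ)|) := by
  have h0 := hM.eps0_pos
  have hεt := epsT_pos h0 t
  have hεle : epsT M.eps0 t ≤ M.eps0 := epsT_le h0.le ht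
  have hnτ' := ntau_hyp_at_t h0.le hβ.le hnτ ht
  have hnposR : (0 : ℝ) < nτ := by exact_mod_cast hnpos
  have hEmax0 : 0 ≤ Emax := le_trans (abs_nonneg _) (hEmax k)
  have hετ := epsTau_pos hβ hnpos
  have hπ := Real.pi_pos
  set ε := epsT M.eps0 t with hεdef
  set m : ℝ := (2 * n + 1 : ℝ) with hmdef
  -- `|2n+1| ≤ βε/2 =: R` and `1 ≤ |2n+1|`
  have hω := (lemma9_pointwise M hβ hεt.le hEmax hnτ' hnpos hn k hle).1
  rw [abs_matsFreq hβ] at hω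
  have hmR : |m| ≤ β * ε / 2 := by
    rw [le_div_iff₀ (by norm_num : (0:ℝ) < 2)]
    have := mul_le_mul_of_nonneg_left hω hβ.le
    have hh : β * (Real.pi / β * |m|) = Real.pi * |m| := by field_simp
    rw [hh] at this
    nlinarith [Real.pi_gt_three, abs_nonneg m]
  have hm1 : 1 ≤ |m| := (abs_two_mul_add_one_le hn).1
  refine ⟨hmR, ?_⟩
  -- `R ≤ nτ/4`, so `|y| = π|m|/nτ ≤ π/4`
  have hR4 : 4 * (β * ε / 2) ≤ nτ := by nlinarith
  set y := epsTau β nτ * matsFreq β n with hydef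
  have hyval : y = Real.pi * m / nτ := epsTau_mul_matsFreq hβ.ne' nτ n
  have hyabs : |y| = Real.pi * |m| / nτ := by
    rw [hyval, abs_div, abs_mul, abs_of_pos hπ, abs_of_pos hnposR]
  have hy4 : |y| ≤ Real.pi / 4 := by
    rw [hyabs, div_le_iff₀ hnposR]
    have : |m| * 4 ≤ nτ := by linarith
    nlinarith
  have hyπ : |y| ≤ Real.pi := le_trans hy4 (by linarith)
  -- chord: `(2√2/π)|y| ≤ |sin y|`, i.e. `2√2|m|/nτ ≤ |sin y|`
  have hch := chord_mul_le_sin (abs_nonneg y) hy4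
  rw [← abs_sin_eq_sin_abs hyπ, hyabs] at hch
  have hsin : 2 * Real.sqrt 2 * |m| / nτ ≤ |Real.sin y| := by
    calc 2 * Real.sqrt 2 * |m| / nτ = 2 * Real.sqrt 2 / Real.pi * (Real.pi * |m| / nτ) := by
          field_simp
      _ ≤ |Real.sin y| := hch
  -- `|iω̂ - E| ≥ |sin y|/ε_τ ≥ 2√2|m|/β`
  have hpd : 2 * Real.sqrt 2 * |m| / β ≤ ‖propDenom M β nτ (matsFreq β n) k‖ := by
    refine le_trans ?_ (abs_sin_div_le_norm_propDenom M hετ _ k)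
    rw [le_div_iff₀ hετ]
    calc 2 * Real.sqrt 2 * |m| / β * epsTau β nτ = 2 * Real.sqrt 2 * |m| / nτ := by
          unfold epsTau; field_simp
      _ ≤ |Real.sin y| := hsin
  have hs2 : 0 < Real.sqrt 2 := by positivity
  have hm0 : 0 < |m| := lt_of_lt_of_le one_pos hm1
  rw [← one_div, one_div_mul_one_div, one_div_mul_one_div]
  apply one_div_le_one_div_of_le (mul_pos (mul_pos two_pos hs2) hm0)
  rw [div_le_iff₀ hβ] at hpd
  calc 2 * Real.sqrt 2 * |m| ≤ ‖propDenom M β nτ (matsFreq β n) k‖ * β := hpd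
    _ = β * ‖propDenom M β nτ (matsFreq β n) k‖ := mul_comm _ _

/-- The Matsubara sum behind the second integral bound:
`β⁻¹ Σ_ω 1(|iω̂ - E(𝐤)| ≤ ε_t)/|iω̂ - E(𝐤)| ≤ log(βε₀/2) · 1(|E(𝐤)| ≤ 2)` (odd harmonic sum `≤ Φ(βε_t/2)/√2 ≤
log(βε₀/2)`; `|E| ≤ 2ε_t ≤ 2` on the support by Lemma 9).
[cite: Salmhofer1998, Proposition 4 (p.18 L70–75), proof p.18 L93–95; proof device of this file for the last display] -/
theorem inner_sum_le {M : ModelData d} (hM : M.Hyp) {Emax β : ℝ} {nτ : ℕ}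
    (hEmax : ∀ p, |M.E p| ≤ Emax) (hβ : 0 < β) (h6 : 6 ≤ β * M.eps0) (hnpos : 0 < nτ)
    (hnτ : 2 * β * (M.eps0 + Emax) ≤ nτ) {t : ℝ} (ht : 0 ≤ t) (k : Mom d) :
    β⁻¹ * ∑ n ∈ matsIdx nτ, shellInd M β nτ t (matsFreq β n) k / ‖propDenom M β nτ (matsFreq β n) k‖
      ≤ Real.log (β * M.eps0 / 2) * (if |M.E k| ≤ 2 then (1 : ℝ) else 0) := by
  have h0 := hM.eps0_pos
  have hεt := epsT_pos h0 t
  have hεle : epsT M.eps0 t ≤ M.eps0 := epsT_le h0.le ht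
  have hnτ' := ntau_hyp_at_t h0.le hβ.le hnτ ht
  have hT3 : Real.log 3 ≤ Real.log (β * M.eps0 / 2) := Real.log_le_log (by norm_num) (by linarith)
  have hT0 : 0 ≤ Real.log (β * M.eps0 / 2) := le_trans (Real.log_nonneg (by norm_num)) hT3
  set ε := epsT M.eps0 t with hεdef
  set R := β * ε / 2 with hRdef
  by_cases hex : ∃ n ∈ matsIdx nτ, ‖propDenom M β nτ (matsFreq β n) k‖ ≤ ε
  · obtain ⟨n₀, hn₀, hle₀⟩ := hex
    have hE : |M.E k| ≤ 2 := by
      have := (lemma9_pointwise M hβ hεt.le hEmax hnτ' hnpos hn₀ k hle₀).2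
      linarith [hM.eps0_le_one]
    rw [if_pos hE, mul_one, Finset.mul_sum]
    -- per-term comparison with the odd harmonic series
    have hterm : ∀ n ∈ matsIdx nτ,
        β⁻¹ * (shellInd M β nτ t (matsFreq β n) k / ‖propDenom M β nτ (matsFreq β n) k‖) ≤
          1 / (2 * Real.sqrt 2) *
            (if |(2 * n + 1 : ℝ)| ≤ R then 1 / |(2 * n + 1 : ℝ)| else 0) := by
      intro n hn
      unfold shellInd
      split_ifs with hle hR
      · exact (per_term_bound hM hEmax hβ hnpos hnτ ht hn k hle).2
      · exact absurd (per_term_bound hM hEmax hβ hnpos hnτ ht hn k hle).1 hR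
      · rw [zero_div, mul_zero]; positivity
      · rw [zero_div, mul_zero, mul_zero]
    refine le_trans (Finset.sum_le_sum hterm) ?_
    rw [← Finset.mul_sum]
    have hsum := sum_inv_odd_le (nτ / 2) R
    have hmats : matsIdx nτ = Finset.Ico (-((nτ / 2 : ℕ) : ℤ)) ((nτ / 2 : ℕ) : ℤ) := rfl
    rw [hmats]
    refine le_trans (mul_le_mul_of_nonneg_left hsum (by positivity)) ?_
    -- `Φ(R)/√2 ≤ log(βε₀/2)`
    have hR0 : 0 < R := by positivity
    have hRB : R ≤ β * M.eps0 / 2 := by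
      rw [hRdef]; gcongr
    have hΦ := max_le_sqrt_two_mul_log hR0 hRB h6
    have hs2 : 0 < Real.sqrt 2 := by positivity
    calc 1 / (2 * Real.sqrt 2) * (2 * max 1 (4 / 3 + 1 / 2 * Real.log (R / 3)))
        = max 1 (4 / 3 + 1 / 2 * Real.log (R / 3)) / Real.sqrt 2 := by
          field_simp
      _ ≤ Real.log (β * M.eps0 / 2) := by
          rw [div_le_iff₀ hs2]; exact hΦ.trans_eq (mul_comm _ _)
  · push Not at hex
    have hzero : ∑ n ∈ matsIdx nτ,
        shellInd M β nτ t (matsFreq β n) k / ‖propDenom M β nτ (matsFreq β n) k‖ = 0 := by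
      refine Finset.sum_eq_zero (fun n hn => ?_)
      unfold shellInd
      rw [if_neg (not_le.mpr (hex n hn)), zero_div]
    rw [hzero, mul_zero]
    exact mul_nonneg hT0 (by split_ifs <;> norm_num)

/-- **Second integral bound: `∫_{Λ*} dk |D̂_t(k)| ≤ V₁ log(βε₀/2)`** (as printed; proved by the direct
route of the module docstring rather than by `C_t = ∫_t^{log(βε₀/2)} ds Ċ_s`).
[cite: Salmhofer1998, Proposition 4 (p.18 L70–75), proof p.18 L93–95] -/
theorem momSum_norm_cutoffCov_le {M : ModelData d} (hM : M.Hyp) {χ₁ : ℝ → ℝ} (hχ : IsCutoff χ₁)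
    {Emax V₁ β : ℝ} {nτ L : ℕ} (hEmax : ∀ p, |M.E p| ≤ Emax)
    (hV : ((Finset.univ.filter fun q : Fin d → Fin L => |M.E (latticeMom M.latt L q)| ≤ 2).card : ℝ)
      / (L : ℝ) ^ d ≤ V₁)
    (hβ : 0 < β) (h6 : 6 ≤ β * M.eps0) (hnpos : 0 < nτ) (hnτ : 2 * β * (M.eps0 + Emax) ≤ nτ)
    {t : ℝ} (ht : 0 ≤ t) :
    momSum β M.latt nτ L (fun ω k => ‖cutoffCov M χ₁ β nτ t ω k‖) ≤
      V₁ * Real.log (β * M.eps0 / 2) := by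
  have h0 := hM.eps0_pos
  have hT3 : Real.log 3 ≤ Real.log (β * M.eps0 / 2) := Real.log_le_log (by norm_num) (by linarith)
  have hT0 : 0 ≤ Real.log (β * M.eps0 / 2) := le_trans (Real.log_nonneg (by norm_num)) hT3
  calc momSum β M.latt nτ L (fun ω k => ‖cutoffCov M χ₁ β nτ t ω k‖)
      ≤ momSum β M.latt nτ L (fun ω k => shellInd M β nτ t ω k / ‖propDenom M β nτ ω k‖) :=
        momSum_mono hβ _ _ _ (fun n _ q => norm_cutoffCov_le h0 hχ t _ _)
    _ = ((L : ℝ) ^ d)⁻¹ * ∑ q : Fin d → Fin L, (β⁻¹ * ∑ n ∈ matsIdx nτ,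
          shellInd M β nτ t (matsFreq β n) (latticeMom M.latt L q) /
            ‖propDenom M β nτ (matsFreq β n) (latticeMom M.latt L q)‖) :=
        momSum_eq_sum _ _ _ _ _
    _ ≤ ((L : ℝ) ^ d)⁻¹ * ∑ q : Fin d → Fin L,
          Real.log (β * M.eps0 / 2) * (if |M.E (latticeMom M.latt L q)| ≤ 2 then (1 : ℝ) else 0) := by
        apply mul_le_mul_of_nonneg_left _ (by positivity)
        exact Finset.sum_le_sum (fun q _ => inner_sum_le hM hEmax hβ h6 hnpos hnτ ht _)
    _ ≤ Real.log (β * M.eps0 / 2) * V₁ := density_le M hT0 hV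
    _ = V₁ * Real.log (β * M.eps0 / 2) := mul_comm _ _

end Sums

/-! ### Assembly: Proposition 4 -/

/-- **Proposition 4 of Salmhofer 1998 holds**: the named fact `FiniteVolumePropagatorBounds`
(licence F-083 of the gate-hubbard-kl wave; typed in `Salmhofer1998Sec5.lean`) is a theorem.
[cite: Salmhofer1998, Proposition 4 (p.18 L45–76), proof p.18 L78–96; Lemma 9 (appendix, TeX LemA1; p.28 L45–96)] -/
theorem FiniteVolumePropagatorBounds_holds : FiniteVolumePropagatorBounds := by
  intro d M hM χ₁ hχ Emax V₁ β nτ L hEmax hV hβ h6 heven hnpos hnτ hL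
  have h0 := hM.eps0_pos
  have hVL := hV L hL
  refine ⟨?_, ?_, ?_, ?_, ?_⟩
  · intro n hn q
    exact contDiff_cutoffCov h0 hχ _ _
  · intro t ht n hn q
    exact cutoffCov_eq_zero_of_log_lt h0 hχ hβ (two_div_beta_le_norm_propDenom M hβ hnpos hn _) ht
  · intro t ht0 htT n hn q
    exact ⟨fun h => (norm_lt_of_cutoffCov_ne_zero h0 hχ h).le,
      fun h => shell_of_cutoffCovDot_ne_zero h0 hχ h⟩
  · intro t ht n hn q
    exact ⟨norm_cutoffCovDot_le h0 hχ _ _ _,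
      four_inv_epsT_le_two_beta h0 hβ (two_div_beta_le_norm_propDenom M hβ hnpos hn _),
      norm_cutoffCov_le_half_beta h0 hχ hβ (two_div_beta_le_norm_propDenom M hβ hnpos hn _)⟩
  · intro t ht
    exact ⟨momSum_norm_cutoffCovDot_le hM hχ hEmax hVL hβ hnpos hnτ ht,
      momSum_norm_cutoffCov_le hM hχ hEmax hVL hβ h6 hnpos hnτ ht⟩


end Salmhofer1998

end Literature.MathematicalPhysics.QuantumLattice.FermiRG
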